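import Mathlib
import Literature.Dynamics.Contraction.ComplexConeContraction

/-!
# Rugh's cone `ℂⁿ₊`: elementary facts and Dubois' pairing lemma (Lemma 3.1, easy half)

Helper file for item stmt-CriticalPhenomena-8789 (`ComplexConeContraction`, route CardyComplexCone
of `CardyFormulaZ2`). We work with the Literature vocabulary of
`Literature/Dynamics/Contraction/ComplexConeContraction.lean`: `rughCone n = ℂⁿ₊`,
`rughConeInt n = Int ℂⁿ₊` (the printed interior `{v : ∀ k l, Re(v_k conj v_l) > 0}`).

Contents:
* `rughConeInt_smul`, `zero_not_mem_rughConeInt`, `star_mem_rughConeInt` — stability facts;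
* `im_nonneg_trans`, `exists_extremal`, `exists_extremal_univ` — every `f ∈ ℂⁿ₊ ∖ {0}` has an
  "extremal" nonzero coordinate `f_k` such that all `f_l conj f_k` lie in the closed first quadrant
  (this is the rotation `x_k = r_k e^{iα_k}, α_k ∈ [0, π/2]` of Dubois' proof of Lemma 3.1, done
  without arguments of complex numbers: the relation `Im(f_l conj f_k) ≥ 0` is a total preorder on
  the nonzero coordinates);
* `sum_mul_ne_zero` — **Dubois 2009, Lemma 3.1 (easy half)**: `Σ f_k w_k ≠ 0` for `f ∈ ℂⁿ₊ ∖ {0}`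
  and `w ∈ Int ℂⁿ₊`; `pairing_ratio_mem_duboisE` — hence `⟨f,y⟩/⟨f,x⟩ ∈ E_{Int ℂⁿ₊}(x,y)` for
  `x ∈ Int ℂⁿ₊` (the easy inclusion in the proof of Lemma 2.1).

Reference: L. Dubois, *Projective metrics and contraction principles for complex cones*, J. London
Math. Soc. 79 (2009), Lemma 3.1.
-/

open scoped ComplexConjugate

namespace Summit.CriticalPhenomena.CardyFormulaZ2.Theorems.ComplexConeContraction

open Literature.Dynamics.Contraction

/-- `Int ℂⁿ₊` is stable under multiplication by a nonzero complex scalar. -/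
theorem rughConeInt_smul {n : ℕ} {v : Fin n → ℂ} (hv : v ∈ rughConeInt n) {c : ℂ} (hc : c ≠ 0) :
    c • v ∈ rughConeInt n := by
  intro k l
  have h : (c • v) k * conj ((c • v) l) = (c * conj c) * (v k * conj (v l)) := by
    simp only [Pi.smul_apply, smul_eq_mul, map_mul]
    ring
  rw [h, Complex.mul_conj, Complex.re_ofReal_mul]
  exact mul_pos (Complex.normSq_pos.2 hc) (hv k l)

/-- Conversely, if `c ≠ 0` and `c • v ∈ Int ℂⁿ₊` then `v ∈ Int ℂⁿ₊`. -/
theorem mem_rughConeInt_of_smul_mem {n : ℕ} {v : Fin n → ℂ} {c : ℂ} (hc : c ≠ 0)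
    (hv : c • v ∈ rughConeInt n) : v ∈ rughConeInt n := by
  have h := rughConeInt_smul hv (inv_ne_zero hc)
  rwa [smul_smul, inv_mul_cancel₀ hc, one_smul] at h

/-- The zero vector is not in `Int ℂⁿ₊` as soon as `n ≥ 1`. -/
theorem zero_not_mem_rughConeInt {n : ℕ} (hn : 0 < n) : (0 : Fin n → ℂ) ∉ rughConeInt n := by
  intro h
  have := h ⟨0, hn⟩ ⟨0, hn⟩
  simp at this

/-- A vector of `Int ℂⁿ₊` (`n ≥ 1`) is nonzero. -/
theorem ne_zero_of_mem_rughConeInt' {n : ℕ} (hn : 0 < n) {v : Fin n → ℂ} (hv : v ∈ rughConeInt n) :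
    v ≠ 0 := fun h => zero_not_mem_rughConeInt hn (h ▸ hv)

/-- `Int ℂⁿ₊` is stable under coordinatewise complex conjugation. -/
theorem star_mem_rughConeInt {n : ℕ} {w : Fin n → ℂ} (hw : w ∈ rughConeInt n) :
    star w ∈ rughConeInt n := by
  intro k l
  have h : star w k * conj (star w l) = conj (w k * conj (w l)) := by
    simp only [Pi.star_apply, Complex.star_def, map_mul, Complex.conj_conj]
  rw [h, Complex.conj_re]
  exact hw k l

/-- Transitivity of the "counter-clockwise" relation inside a quarter plane: if `a conj b` and
`b conj c` both lie in the closed first quadrant and `b ≠ 0`, then `Im(a conj c) ≥ 0`. -/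
theorem im_nonneg_trans {a b c : ℂ} (hb : b ≠ 0)
    (h1 : 0 ≤ (a * conj b).re) (h1' : 0 ≤ (a * conj b).im)
    (h2 : 0 ≤ (b * conj c).re) (h2' : 0 ≤ (b * conj c).im) : 0 ≤ (a * conj c).im := by
  have key : (a * conj c) * (Complex.normSq b : ℂ) = (a * conj b) * (b * conj c) := by
    rw [← Complex.mul_conj]
    ring
  have him : (a * conj c).im * Complex.normSq b = ((a * conj b) * (b * conj c)).im := by
    rw [← key, Complex.im_mul_ofReal]
  have hpos : 0 < Complex.normSq b := Complex.normSq_pos.2 hb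
  have hnn : 0 ≤ ((a * conj b) * (b * conj c)).im := by
    rw [Complex.mul_im]
    exact add_nonneg (mul_nonneg h1 h2') (mul_nonneg h1' h2)
  rw [← him] at hnn
  exact nonneg_of_mul_nonneg_left hnn hpos

/-- Extremal coordinate: in a vector of `ℂⁿ₊`, among any non-empty finite set `T` of nonzero
coordinates there is one, `f_k`, such that `Im(f_l conj f_k) ≥ 0` for all `l ∈ T`
(all `f_l`, `l ∈ T`, are counter-clockwise from `f_k` within the quarter plane). -/
theorem exists_extremal {n : ℕ} {f : Fin n → ℂ} (hf : f ∈ rughCone n) (T : Finset (Fin n)) :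
    (∀ k ∈ T, f k ≠ 0) → T.Nonempty → ∃ k ∈ T, ∀ l ∈ T, 0 ≤ (f l * conj (f k)).im := by
  classical
  induction T using Finset.induction_on with
  | empty => intro _ h; exact absurd h Finset.not_nonempty_empty
  | insert j T hj ih =>
    intro hne _
    have hself : ∀ i : Fin n, 0 ≤ (f i * conj (f i)).im := fun i => by
      rw [Complex.mul_conj, Complex.ofReal_im]
    by_cases hT : T.Nonempty
    · obtain ⟨k, hkT, hk⟩ := ih (fun k hk => hne k (Finset.mem_insert_of_mem hk)) hT
      by_cases hjk : 0 ≤ (f j * conj (f k)).im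
      · refine ⟨k, Finset.mem_insert_of_mem hkT, fun l hl => ?_⟩
        rcases Finset.mem_insert.1 hl with rfl | hl
        · exact hjk
        · exact hk l hl
      · refine ⟨j, Finset.mem_insert_self _ _, fun l hl => ?_⟩
        rcases Finset.mem_insert.1 hl with rfl | hl
        · exact hself l
        · have hkj : 0 ≤ (f k * conj (f j)).im := by
            have h' : f k * conj (f j) = conj (f j * conj (f k)) := by
              simp only [map_mul, Complex.conj_conj, mul_comm]
            rw [h', Complex.conj_im]
            linarith [lt_of_not_ge hjk]
          exact im_nonneg_trans (hne k (Finset.mem_insert_of_mem hkT)) (hf l k) (hk l hl)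
            (hf k j) hkj
    · rw [Finset.not_nonempty_iff_eq_empty] at hT
      subst hT
      refine ⟨j, Finset.mem_insert_self _ _, fun l hl => ?_⟩
      rw [Finset.mem_insert] at hl
      rcases hl with rfl | hl
      · exact hself l
      · exact absurd hl (Finset.notMem_empty _)

/-- Extremal coordinate of a nonzero vector of `ℂⁿ₊`: some `f_k ≠ 0` with `Im(f_l conj f_k) ≥ 0` for
all `l` (and `Re(f_l conj f_k) ≥ 0` by the cone condition): after multiplication by `conj f_k` the
vector lies in the closed first quadrant. -/
theorem exists_extremal_univ {n : ℕ} {f : Fin n → ℂ} (hf : f ∈ rughCone n) (hf0 : f ≠ 0) :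
    ∃ k, f k ≠ 0 ∧ ∀ l, 0 ≤ (f l * conj (f k)).im := by
  classical
  obtain ⟨k0, hk0⟩ := Function.ne_iff.1 hf0
  obtain ⟨k, hkT, hk⟩ := exists_extremal hf (Finset.univ.filter fun k => f k ≠ 0)
    (fun k hk => (Finset.mem_filter.1 hk).2) ⟨k0, Finset.mem_filter.2 ⟨Finset.mem_univ _, hk0⟩⟩
  refine ⟨k, (Finset.mem_filter.1 hkT).2, fun l => ?_⟩
  by_cases hl : f l = 0
  · simp [hl]
  · exact hk l (Finset.mem_filter.2 ⟨Finset.mem_univ _, hl⟩)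

/-- **Dubois 2009, Lemma 3.1 (easy half of (3.16))**: the bilinear pairing of a nonzero vector of
`ℂⁿ₊` with a vector of `Int ℂⁿ₊` does not vanish: `Σ_k f_k w_k ≠ 0`. -/
theorem sum_mul_ne_zero {n : ℕ} {f w : Fin n → ℂ} (hf : f ∈ rughCone n) (hf0 : f ≠ 0)
    (hw : w ∈ rughConeInt n) : ∑ k, f k * w k ≠ 0 := by
  obtain ⟨k, hk0, hk⟩ := exists_extremal_univ hf hf0
  have hn : 0 < n := k.pos
  have hw' : star w ∈ rughConeInt n := star_mem_rughConeInt hw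
  obtain ⟨j, -, hj⟩ :=
    exists_extremal_univ (rughConeInt_subset n hw') (ne_zero_of_mem_rughConeInt' hn hw')
  -- `X l = f l * conj (f k)` lies in the closed first quadrant, `Y l = w l * conj (w j)` in the
  -- open-right / lower half plane
  have hYim : ∀ l, (w l * conj (w j)).im ≤ 0 := fun l => by
    have h1 := hj l
    have h2 : star w l * conj (star w j) = conj (w l * conj (w j)) := by
      simp only [Pi.star_apply, Complex.star_def, map_mul, Complex.conj_conj]
    rw [h2, Complex.conj_im] at h1
    linarith
  intro hsum
  have hS : ∑ l, (f l * conj (f k)) * (w l * conj (w j)) = 0 := by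
    have h : ∑ l, (f l * conj (f k)) * (w l * conj (w j)) =
        (conj (f k) * conj (w j)) * ∑ l, f l * w l := by
      rw [Finset.mul_sum]
      exact Finset.sum_congr rfl fun l _ => by ring
    rw [h, hsum, mul_zero]
  have hre : ∀ l, 0 ≤ ((f l * conj (f k)) * (w l * conj (w j))).re := fun l => by
    rw [Complex.mul_re]
    nlinarith [hf l k, hk l, (hw l j).le, hYim l]
  have hk_term : 0 < ((f k * conj (f k)) * (w k * conj (w j))).re := by
    rw [Complex.mul_conj, Complex.re_ofReal_mul]
    exact mul_pos (Complex.normSq_pos.2 hk0) (hw k j)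
  have hpos : 0 < (∑ l, (f l * conj (f k)) * (w l * conj (w j))).re := by
    rw [Complex.re_sum]
    exact lt_of_lt_of_le hk_term
      (Finset.single_le_sum (f := fun l => ((f l * conj (f k)) * (w l * conj (w j))).re)
        (fun l _ => hre l) (Finset.mem_univ k))
  rw [hS, Complex.zero_re] at hpos
  exact lt_irrefl 0 hpos

/-- For `x ∈ Int ℂⁿ₊` and a test vector `f ∈ ℂⁿ₊ ∖ {0}` the ratio `⟨f,y⟩/⟨f,x⟩` lies in Dubois' set
`E_{Int ℂⁿ₊}(x,y) = {z : z x − y ∉ Int ℂⁿ₊}` (`⟨f, (⟨f,y⟩/⟨f,x⟩) x − y⟩ = 0`, so this vector is not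
in `Int ℂⁿ₊` by the pairing lemma; cf. the proof of Dubois' Lemma 2.1). -/
theorem pairing_ratio_mem_duboisE {n : ℕ} {x y f : Fin n → ℂ} (hx : x ∈ rughConeInt n)
    (hf : f ∈ rughCone n) (hf0 : f ≠ 0) :
    (∑ k, f k * y k) / (∑ k, f k * x k) ∈ duboisE (rughConeInt n) x y := by
  intro hmem
  have hX : ∑ k, f k * x k ≠ 0 := sum_mul_ne_zero hf hf0 hx
  apply sum_mul_ne_zero hf hf0 hmem
  simp only [Pi.sub_apply, Pi.smul_apply, smul_eq_mul, mul_sub, Finset.sum_sub_distrib]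
  have e : ∑ k, f k * ((∑ k, f k * y k) / (∑ k, f k * x k) * x k) =
      (∑ k, f k * y k) / (∑ k, f k * x k) * ∑ k, f k * x k := by
    rw [Finset.mul_sum]
    exact Finset.sum_congr rfl fun k _ => by ring
  rw [e, div_mul_cancel₀ _ hX, sub_self]

end Summit.CriticalPhenomena.CardyFormulaZ2.Theorems.ComplexConeContraction
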